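import Literature.NumberTheory.Transcendental.KZGroundingRelations
import Literature.NumberTheory.Transcendental.KZLogCalculusProofs
import Summits.KontsevichZagierPeriods.KontsevichZagierPeriods.Theorems.UnfoldedStokesStokesGenerationStubSpanToReps
import HarnessLib

/-!
# `ContinuousCubification` (stmt-KontsevichZagierPeriods-17853), line `SketchIdeator1`:
# stub `stub_mergeSum`

Registered stub S5 of the line `korobov_damping` / `SketchIdeator1` of the crux
`ContinuousCubification` (route UnfoldedStokes): **merging closed-cube representations.**
Finitely many integral representations `t C` (`C ∈ 𝒞`) on the closed unit cube
`[0,1]^M = Set.pi univ (fun _ => Icc 0 1)` whose integrands are continuous on the closed cube are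
congruent, as a formal sum and modulo the moves of the Kontsevich–Zagier calculus (`KZ.relations`),
to the SINGLE closed-cube representation `T` with integrand `x ↦ ∑_{C ∈ 𝒞} (t C).integrand x`,
which is again continuous on the closed cube.

Proof. `T` is a representation: the closed cube is `ℚ`-semialgebraic
(`StokesGenerationLine.isSemialgebraic_cubePi`), a finite sum of `ℚ`-semialgebraic functions is
`ℚ`-semialgebraic (`KZ.isSemialgebraicFunOn_finset_sum`, [Bochnak–Coste–Roy 1998, Prop. 2.2.6]),
and a function continuous on a compact set is integrable on it. The congruence
`[T] − ∑_C [t C] ∈ relations` is iterated additivity of the integrand, rule (1b)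
[Kontsevich–Zagier 2001, §1.2, rule (1)], landed as `KZ.of_sub_sum_integrand_mem_relations`;
`relations` is a subgroup, so the opposite difference lies in it as well. No definition is
introduced.

References: M. Kontsevich, D. Zagier, *Periods* (2001), §1.2.
-/

noncomputable section

-- `Summit.KontsevichZagierPeriods.KontsevichZagierPeriods.…` is the tree's mandated layout
-- (single-conjunct summit).
set_option linter.dupNamespace false

namespace Summit.KontsevichZagierPeriods.KontsevichZagierPeriods.ContinuousCubificationLine

open MeasureTheory Set
open Literature.NumberTheory.Transcendental
open Literature.NumberTheory.Transcendental.KZ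
open Literature.ModelTheory.ExponentialFields (IsSemialgebraic)
open Summit.KontsevichZagierPeriods.KontsevichZagierPeriods.StokesGenerationLine
  (isSemialgebraic_cubePi)

/-! ## The merged representation -/

/-- **The merged closed-cube representation.** For finitely many representations `t C`
(`C ∈ 𝒞`) on the closed unit cube with integrands continuous on it, the closed cube with
integrand `x ↦ ∑_{C ∈ 𝒞} (t C).integrand x` is an integral representation `T` (the sum is
`ℚ`-semialgebraic on the cube, continuous on the compact cube hence integrable), and
`[T] − ∑_C [t C] ∈ relations` by iterated additivity of the integrand (rule (1b)).
[Kontsevich–Zagier 2001, §1.2, rule (1)] [cite: KontsevichZagier2001, §1.2 rule (1)] -/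
theorem exists_mergeRep (M : ℕ) (𝒞 : Finset (Set (Fin M → ℝ)))
    (t : Set (Fin M → ℝ) → IntegralRep M)
    (ht : ∀ C ∈ 𝒞, (t C).domain = Set.pi Set.univ (fun _ : Fin M => Set.Icc (0:ℝ) 1) ∧
      ContinuousOn (t C).integrand (Set.pi Set.univ (fun _ : Fin M => Set.Icc (0:ℝ) 1))) :
    ∃ T : IntegralRep M, T.domain = Set.pi Set.univ (fun _ : Fin M => Set.Icc (0:ℝ) 1) ∧
      (T.integrand = fun x => ∑ C ∈ 𝒞, (t C).integrand x) ∧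
      ContinuousOn T.integrand (Set.pi Set.univ (fun _ : Fin M => Set.Icc (0:ℝ) 1)) ∧
      of T - ∑ C ∈ 𝒞, of (t C) ∈ relations := by
  -- continuity of the finite sum on the closed cube
  have hc : ContinuousOn (fun x => ∑ C ∈ 𝒞, (t C).integrand x)
      (Set.pi Set.univ (fun _ : Fin M => Set.Icc (0:ℝ) 1)) :=
    continuousOn_finsetSum 𝒞 fun C hC => (ht C hC).2
  -- the merged representation `[[0,1]^M, ∑_C (t C).integrand]`
  let T : IntegralRep M :=
    { domain := Set.pi Set.univ (fun _ : Fin M => Set.Icc (0:ℝ) 1)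
      integrand := fun x => ∑ C ∈ 𝒞, (t C).integrand x
      isSemialgebraic_domain := isSemialgebraic_cubePi M
      isSemialgebraicFunOn_integrand :=
        isSemialgebraicFunOn_finset_sum 𝒞 (isSemialgebraic_cubePi M) fun C hC =>
          (ht C hC).1 ▸ (t C).isSemialgebraicFunOn_integrand
      integrableOn := hc.integrableOn_compact (isCompact_univ_pi fun _ => isCompact_Icc) }
  exact ⟨T, rfl, rfl, hc,
    of_sub_sum_integrand_mem_relations 𝒞 t T (fun C hC => (ht C hC).1) fun _ _ => rfl⟩

/-! ## The stub -/

/-- STUB S5 (`S`): **merging closed-cube representations.** Finitely many representations on the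
closed unit cube with integrands continuous on it are congruent, as a sum, to the single closed-cube
representation with integrand their sum (iterated rule (1b),
`KZ.of_sub_sum_integrand_mem_relations`; continuity, `ℚ`-semialgebraicity and integrability of
finite sums).
[Kontsevich–Zagier 2001, §1.2, rule (1)] [cite: KontsevichZagier2001, §1.2 rule (1)] -/
theorem stub_mergeSum :
    ∀ (M : ℕ) (𝒞 : Finset (Set (Fin M → ℝ))) (t : Set (Fin M → ℝ) → IntegralRep M),
      (∀ C ∈ 𝒞, (t C).domain = Set.pi Set.univ (fun _ : Fin M => Set.Icc (0:ℝ) 1) ∧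
        ContinuousOn (t C).integrand (Set.pi Set.univ (fun _ : Fin M => Set.Icc (0:ℝ) 1))) →
      ∃ T : IntegralRep M, T.domain = Set.pi Set.univ (fun _ : Fin M => Set.Icc (0:ℝ) 1) ∧
        ContinuousOn T.integrand (Set.pi Set.univ (fun _ : Fin M => Set.Icc (0:ℝ) 1)) ∧
        ∑ C ∈ 𝒞, of (t C) - of T ∈ relations := by
  intro M 𝒞 t ht
  obtain ⟨T, hTd, -, hTc, hrel⟩ := exists_mergeRep M 𝒞 t ht
  refine ⟨T, hTd, hTc, ?_⟩
  rw [← neg_sub]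
  exact relations.neg_mem hrel

end Summit.KontsevichZagierPeriods.KontsevichZagierPeriods.ContinuousCubificationLine

end
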